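import Summits.QuantumFields.YangMills.Theorems.UnitScaleTiltHalvingP1FlatCorePreGauge
import Summits.QuantumFields.YangMills.Theorems.UnitScaleTiltProp8ChartDoubleBarDefs
import Literature.MathematicalPhysics.QuantumFieldTheory.Balaban1983to89.B8Ineq129
import Literature.MathematicalPhysics.QuantumFieldTheory.Balaban1983to89.B7Prop4Flat
import Literature.MathematicalPhysics.QuantumFieldTheory.Balaban1983to89.Node00.TorusCoverLevels
import HarnessLib

/-!
# Line H (`BirthV10.stub_halvingStep`, stmt-QuantumFields-19200) — LEMMA B-al-2, brick **(B-v): ★★★ THE TOWER** — the `k`-level induction «`H_j ⇒ H_{j+1}`» from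
# `H_0 : ρ_0 = 0` to the member statement «the COMB top average of the pulled pre-gauged field IS the pulled torus DOUBLE-BAR top average up to a k-UNIFORM
# second-order defect, with NO gauge factor» ([Balaban1985Averaging] (42)∕(43) vs (89)∕(127); [Balaban1987RG1] (0.4)), MODULO the one-level step (B-iv)

Cell `ym3-torus` (HUMAN RULING D-0037: YM₃ on T³ is ladder rung R3 — NOT d = 4, NOT infinite volume, NOT a mass gap, NOT the Clay problem), width seat `ym3-torus-px3` gen 5
(B-al «second» per LEAD-H ★w5-19200 g7 WORD 10 (2); (B-v) pen after ★w3-19200 g10's FINAL HANDOFF 04:01Z).  `--supports stmt-QuantumFields-19200 --as helper`; THEOREMS ONLY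
(0 `def`, 0 `sorry`, standard axioms); count-neutral; nothing here claims (B-iv), B-al-3∕4, the (b)-row, (M2′), `H42topCrossT`, the stub, the crux or the gap.

WHY.  LEAD-H WORD 20 (3): the (b)-row of the (M2′) assembly ✓p694481 at the member is «the one remaining analytic input» of v10 (after which line H displays nothing);
its supplier is w3-20520 g9's B-al-3 door, whose row (R-cmp) is LEMMA B-al-2 = ★w3-19200 g10's SIGNATURE v1 (`SIGNATURE-B-al-2.w3g10.lean.txt`, cea012fa; Φ ≡ 1):
for the pre-gauged member field `X̂ = (U^{gJ})♭` with pulled comb tower `C_j = avgIter L (pull X̂ 0) j` (ε₀-regular everywhere: J3 (a) `InAk` on `univ`; block-axial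
below the top: J3 (b)) and torus double-bar tower `D_j = dbarIterU j X̂`, at EVERY top bond: `‖D_k(π_k z, ν)⁻¹·C_k(z, ν) − 1‖ ≤ C_Bal·ε₀²`, `k = K − n`.  w3 g10 landed the
one-step bricks (B-al-1 ✓p691536, (B-i)(B-ii) ✓p693551, (B-iii) `…DbarLipschitz[Core]`) and left the STEP (B-iv) as a draft (`CombStep-B-iv-DRAFT.w3g10.lean`) and the
TOWER (B-v) unwritten.  THIS FILE is (B-v) in the pattern of ✓`Prop8ChartDoubleBarIterSmall` (which took its one-step letter B1 as the hypothesis `hstep` with the constant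
displayed): the STEP is the HYPOTHESIS `hstep` — w3 g10's draft CLAIM VERBATIM in its GLOBAL form (H_j at every bond, block-axiality at every block, plaquettes on
every box) — and the file proves the k-level induction with the per-level data supplied from the socket guards ALONE, the recursion
`ρ_{j+1} = (11∕10)·A·ρ_j + 5·c₁·(L·δc·p_j)²` closed k-UNIFORMLY (geometric, ratio `(11∕10)A∕L⁴ ≤ 2∕3`; the concrete instance `level_budget` of the GENERIC tower arithmetic
✓`HalvingBalLevelRecursion.tower_of_step_top` of px10 g4 — inlined here because the (B-iv) windows are threaded level by level through the data induction, ★★OWNER g29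
04:11:16Z «an inlined instance of a generic lemma is not a twin»), and the constant PINNED: `ρ_k ≤ 240·c₁·δc²·ε₀²`
(`c₁ = C2 d + 40000(d+2)²` ✓B-al-1, `δc = (2dL+1)(d(L−1)+L)` ✓(B-i), `A = 2((d+2)L + L + 2d⌊(L−1)∕2⌋)` ✓(B-iii)).

WHAT IS PROVED (namespace `…Theorems.HalvingCombTorusTower`; member `(F, n, K)`, values `M₂(ℂ)`):
* §1 `transl_zero_eq_coverAt` (the based pullback at `0` reads `coverAt`), `base_level` (H_0 with `ρ_0 = 0`: `D_0(π_0 b)⁻¹·C_0(b) = 1`).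
* §2 per-level data from the guards: `avgIter_mem_U1` (`C_j` is `SU(2)`-valued ⊂ `U1`, lit ✓`prop2_explicit`), `plaqSmall_avgIter_level` (plaquettes of `C_j` on EVERY box
  `≤ p_j := 4ε₀·(Lʲ)²·(Lᵏ)⁻²` — ✓`pdev_pull_lt` ∘ lit ✓`pdev_avgIter_lt_two_alpha` at `α₀ := 2ε₀(Lʲ)²(Lᵏ)⁻²` ∘ lit ✓`plaqSmall_of_pdev`), `level_budget` (the scalar step
  `(11∕10)A·r_j + 5c₁(L·δc·p_j)² ≤ r_{j+1}` for `r_j := 3T·(Lʲ)⁴(Lᵏ)⁻⁴∕L²`, `T = 80c₁δc²ε₀²`, under `33A ≤ 20L⁴`).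
* §3 ★★★ `comb_eq_dbar_mul_defect_of_step` — SIGNATURE v1's conclusion with `C_Bal·ε₀² := 240·c₁·δc²·ε₀²`, hypotheses = `hstep` + the socket guards (a) `InAk` on `univ`,
  (b) block-axiality + the scalar windows in the socket's own letters (`C0 d·(2ε₀) ≤ 1∕3`, `2(2ε₀) ≤ c2′`, the (B-iv) windows at the top level, `33A ≤ 20L⁴`);
  `hblk_of_inAx` + ★★★ `comb_eq_dbar_mul_defect_of_step_inAx` — the same with (b) read from the B-al-3 door's guard `∀ m′ ≤ K−n, ∀ Λ, InAx L m′ Λ 1 U′` (lit ✓`inAx_iff`).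
HONEST SCOPE.  B-al-2 MODULO (B-iv): `hstep` is displayed, not proved (px15 g4's offer ∕ a w3-19200 successor); the curvature COROLLARY ★ is a sibling file; the numeric value
`240c₁δc² ≈ 8.2·10¹²` at `d = L = 3` supersedes SIGNATURE v1's provisional `10¹⁰L²` (bus px3 g5 04:09Z).  NOT a claim about the stub, the crux, the rung or a mass gap.

References: T. Bałaban, CMP **98** (1985) 17–51 [Balaban1985Averaging] ((11) p.19, (42)–(43) pp.23–24, Prop. 2 (52)–(54) p.26, (89) p.31, (127) p.36, Prop. 4
(134)–(135) pp.38–39); CMP **109** (1987) 249–301 [Balaban1987RG1] ((0.1)–(0.4) pp.251–253); CMP **99** (1985) 75–102 [Balaban1985RegularSpaces] ((1.7) p.77, (1.15) p.78).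
-/

set_option autoImplicit false

noncomputable section

open scoped BigOperators Matrix.Norms.L2Operator
open NormedSpace

namespace Summit.QuantumFields.YangMills.Theorems.HalvingCombTorusTower

open Literature.MathematicalPhysics.QuantumFieldTheory.Balaban1983to89
open Literature.MathematicalPhysics.QuantumFieldTheory.Balaban1983to89.T3ContinuumYM3Torus
open B7Prop1Explicit renaming Site → LSite
open B7Prop1Explicit (e boxVec axialFn bavg U1)
open B7Prop2Explicit (avgIter avgIter_zero avgIter_succ rescale_apply pdev pdev_nonneg C0 c2' AvgClosed prop2_explicit)
open B7Prop2SpecialUnitary (specialUnitaryUnits)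
open B7AvgClosedSpecialUnitarySharp (avgClosed_specialUnitary_of_le_twentyone)
open B7AvgGaugeCovariance (pdev_avgIter_lt_two_alpha)
open B7Prop4Flat (C2 c4)
open B8Ineq129 (plaqSmall_of_pdev)
open B8Ineq132 (InAk Under)
open B8Eq119TwistedAxial (InAx inAx_iff)
open B8Lemma1NonAbelian (PlaqSmall)
open B10Eq27TorusAxialLog (pull pull_apply transl unitsField toUField)
open Node00 (coverAt coverAt_apply)
open Summit.QuantumFields.YangMills.Theorems.Prop7AxialReprPrint (pull_toUField_mem pdev_pull_lt)
open Summit.QuantumFields.YangMills.Theorems.Prop8ChartDoubleBar (dbarAvgU dbarIterU dbarIterU_zero dbarIterU_succ)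

variable (F : T3Family) {n K : ℕ}

/-! ## §1 The base level -/

/-- The based pullback at the origin reads the cover: `transl 0 z = π_j z`. [cite: Balaban1987RG1, (0.1) p.251] (bookkeeping) -/
theorem transl_zero_eq_coverAt {P : Params} (j : ℕ) (z : LSite P.d) : transl (0 : Site P j) z = coverAt P j z := by
  funext ν
  simp only [transl, coverAt_apply]
  exact zero_add _

/-- **H₀ (`ρ₀ = 0`)**: at level `0` the comb tower and the double-bar tower are the field itself — `D_0(π_0 b)⁻¹·C_0(b) = 1` for `C_0 = pull X̂ 0`, `D_0 = X̂`.
[cite: Balaban1985Averaging, (43) p.24, (127) p.36] -/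
theorem base_level {P : Params} {𝔸 : Type*} [NormedRing 𝔸] [NormedAlgebra ℂ 𝔸] [CompleteSpace 𝔸] (X : GaugeField P 0 𝔸ˣ) (x : LSite P.d) (μ : Fin P.d) :
    ‖((((dbarIterU 0 X) ⟨coverAt P 0 x, μ⟩)⁻¹ * avgIter P.L (pull X 0) 0 x μ : 𝔸ˣ) : 𝔸) - 1‖ = 0 := by
  rw [dbarIterU_zero, avgIter_zero, pull_apply, transl_zero_eq_coverAt, inv_mul_cancel, Units.val_one, sub_self, norm_zero]

/-! ## §2 Per-level data from the socket guards -/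

section Level

/-- `SU(2)` is closed under the (42) average on small fields (lit, `N ≤ 21`). [cite: Balaban1985Averaging, (42)-(43) pp.23-24] -/
theorem avgClosed_su2 (d L : ℕ) : AvgClosed d L (specialUnitaryUnits (Fin 2)) :=
  avgClosed_specialUnitary_of_le_twentyone (by norm_num) d L

/-- The level-`j` Prop.-2 threshold `α₀(j) := 2ε₀·(Lʲ)²·(Lᵏ)⁻²` reproduces the fine-level hypothesis (52): `α₀(j)·(Lʲ)⁻² = 2ε₀·(Lᵏ)⁻²`. [cite: Balaban1985Averaging, (52) p.26] (arithmetic) -/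
theorem alpha_level_mul {L : ℝ} (hL : 0 < L) (ε₀ : ℝ) (j k : ℕ) :
    2 * ε₀ * (L ^ j) ^ 2 * ((L ^ k)⁻¹) ^ 2 * ((L ^ j)⁻¹) ^ 2 = 2 * ε₀ * ((L ^ k)⁻¹) ^ 2 := by
  have hj : L ^ j ≠ 0 := pow_ne_zero _ hL.ne'
  field_simp

/-- `α₀(j) ≤ 2ε₀` for `j ≤ k` (`L ≥ 1`, `ε₀ ≥ 0`). [cite: Balaban1985Averaging, (52) p.26] (arithmetic) -/
theorem alpha_level_le {L : ℝ} (hL : 1 ≤ L) {ε₀ : ℝ} (hε₀ : 0 ≤ ε₀) {j k : ℕ} (hjk : j ≤ k) :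
    2 * ε₀ * (L ^ j) ^ 2 * ((L ^ k)⁻¹) ^ 2 ≤ 2 * ε₀ := by
  have hL0 : 0 < L := by linarith
  have hq : (L ^ j) ^ 2 * ((L ^ k)⁻¹) ^ 2 ≤ 1 := by
    rw [← mul_pow, ← div_eq_mul_inv]
    have h1 : L ^ j / L ^ k ≤ 1 := (div_le_one (pow_pos hL0 k)).mpr (pow_le_pow_right₀ hL hjk)
    have h0 : 0 ≤ L ^ j / L ^ k := by positivity
    nlinarith
  have : 2 * ε₀ * (L ^ j) ^ 2 * ((L ^ k)⁻¹) ^ 2 = 2 * ε₀ * ((L ^ j) ^ 2 * ((L ^ k)⁻¹) ^ 2) := by ring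
  rw [this]
  nlinarith

variable {P : Params}

/-- **THE COMB TOWER IS `SU(2)`-VALUED AT EVERY LEVEL** `j ≤ k` for an `SU(2)`-valued fine field with `(52)` at threshold `2ε₀L^{−2k}` and `ε₀` Prop.-2-small.
[cite: Balaban1985Averaging, Prop. 2 (52)-(54) p.26, (42)-(43) pp.23-24] -/
theorem avgIter_mem_su2 (U' : LSite P.d → Fin P.d → (Matrix (Fin 2) (Fin 2) ℂ)ˣ) (hU' : ∀ z κ, U' z κ ∈ specialUnitaryUnits (Fin 2))
    {ε₀ : ℝ} (hε₀ : 0 < ε₀) (hα3 : C0 P.d * (2 * ε₀) ≤ 1 / 3) (hα2 : 2 * (2 * ε₀) ≤ c2' P.d P.L) {k : ℕ}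
    (h52 : pdev U' < 2 * ε₀ * (((P.L : ℝ) ^ k)⁻¹) ^ 2) {j : ℕ} (hjk : j ≤ k) (x : LSite P.d) (κ : Fin P.d) :
    avgIter P.L U' j x κ ∈ specialUnitaryUnits (Fin 2) := by
  have hL2 : 2 ≤ P.L := P.hL.2
  have hL1 : (1 : ℝ) ≤ P.L := by exact_mod_cast (le_trans (by norm_num) hL2)
  have h52j : pdev U' < 2 * ε₀ * (((P.L : ℝ) ^ j)⁻¹) ^ 2 := B7AvgGaugeCovariance.hyp52_mono (le_trans (by norm_num) hL2) (by positivity) hjk h52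
  exact (prop2_explicit P.L hL2 (avgClosed_su2 P.d P.L) j U' hU' (by positivity) hα3 hα2 h52j).2 j le_rfl x κ

/-- hence `U1`-valued. [cite: Balaban1985Averaging, Prop. 2 p.26] -/
theorem avgIter_mem_U1 (U' : LSite P.d → Fin P.d → (Matrix (Fin 2) (Fin 2) ℂ)ˣ) (hU' : ∀ z κ, U' z κ ∈ specialUnitaryUnits (Fin 2))
    {ε₀ : ℝ} (hε₀ : 0 < ε₀) (hα3 : C0 P.d * (2 * ε₀) ≤ 1 / 3) (hα2 : 2 * (2 * ε₀) ≤ c2' P.d P.L) {k : ℕ}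
    (h52 : pdev U' < 2 * ε₀ * (((P.L : ℝ) ^ k)⁻¹) ^ 2) {j : ℕ} (hjk : j ≤ k) (x : LSite P.d) (κ : Fin P.d) :
    avgIter P.L U' j x κ ∈ U1 (Matrix (Fin 2) (Fin 2) ℂ) :=
  B7Prop2SpecialUnitary.specialUnitaryUnits_le_U1 (avgIter_mem_su2 U' hU' hε₀ hα3 hα2 h52 hjk x κ)

/-- **PLAQUETTES OF THE LEVEL-`j` COMB AVERAGE ON EVERY BOX**: `≤ p_j := 4ε₀·(Lʲ)²·(Lᵏ)⁻²` — Prop. 2 at threshold `α₀(j) = 2ε₀(Lʲ)²(Lᵏ)⁻²` («`< 2α₀`»), the LOCAL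
currency of memo 67606d20 (F3). [cite: Balaban1985Averaging, Prop. 2 (54) p.26; Balaban1985RegularSpaces, (1.7) p.77] -/
theorem plaqSmall_avgIter_level (U' : LSite P.d → Fin P.d → (Matrix (Fin 2) (Fin 2) ℂ)ˣ) (hU' : ∀ z κ, U' z κ ∈ specialUnitaryUnits (Fin 2))
    {ε₀ : ℝ} (hε₀ : 0 < ε₀) (hα3 : C0 P.d * (2 * ε₀) ≤ 1 / 3) (hα2 : 2 * (2 * ε₀) ≤ c2' P.d P.L) {k : ℕ}
    (h52 : pdev U' < 2 * ε₀ * (((P.L : ℝ) ^ k)⁻¹) ^ 2) {j : ℕ} (hjk : j ≤ k) (lo hi : LSite P.d) :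
    PlaqSmall (avgIter P.L U' j) lo hi (4 * ε₀ * ((P.L : ℝ) ^ j) ^ 2 * (((P.L : ℝ) ^ k)⁻¹) ^ 2) := by
  have hL2 : 2 ≤ P.L := P.hL.2
  have hL0 : (0 : ℝ) < P.L := by exact_mod_cast (lt_of_lt_of_le (by norm_num) hL2)
  have hL1 : (1 : ℝ) ≤ P.L := by exact_mod_cast (le_trans (by norm_num) hL2)
  set α : ℝ := 2 * ε₀ * ((P.L : ℝ) ^ j) ^ 2 * (((P.L : ℝ) ^ k)⁻¹) ^ 2 with hαdef
  have hα : 0 < α := by positivity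
  have hαle : α ≤ 2 * ε₀ := alpha_level_le hL1 hε₀.le hjk
  have hα3' : C0 P.d * α ≤ 1 / 3 := (mul_le_mul_of_nonneg_left hαle (B7Prop2Explicit.C0_pos P.d).le).trans hα3
  have hα2' : 2 * α ≤ c2' P.d P.L := by linarith
  have h52j : pdev U' < α * (((P.L : ℝ) ^ j)⁻¹) ^ 2 := by rw [hαdef, alpha_level_mul hL0]; exact h52
  have hp := pdev_avgIter_lt_two_alpha P.L hL2 (avgClosed_su2 P.d P.L) j U' hU' hα hα3' hα2' h52j j le_rfl
  have hmem : ∀ x κ, avgIter P.L U' j x κ ∈ U1 (Matrix (Fin 2) (Fin 2) ℂ) := fun x κ => avgIter_mem_U1 U' hU' hε₀ hα3 hα2 h52 hjk x κ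
  have h4 : 2 * α = 4 * ε₀ * ((P.L : ℝ) ^ j) ^ 2 * (((P.L : ℝ) ^ k)⁻¹) ^ 2 := by rw [hαdef]; ring
  rw [← h4]
  exact plaqSmall_of_pdev hmem hp.le lo hi

/-- `p_j ≤ 4ε₀` (`j ≤ k`). [cite: Balaban1985Averaging, (54) p.26] (arithmetic) -/
theorem p_level_le {L : ℝ} (hL : 1 ≤ L) {ε₀ : ℝ} (hε₀ : 0 ≤ ε₀) {j k : ℕ} (hjk : j ≤ k) :
    4 * ε₀ * (L ^ j) ^ 2 * ((L ^ k)⁻¹) ^ 2 ≤ 4 * ε₀ := by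
  have h := alpha_level_le hL hε₀ hjk
  have : 4 * ε₀ * (L ^ j) ^ 2 * ((L ^ k)⁻¹) ^ 2 = 2 * (2 * ε₀ * (L ^ j) ^ 2 * ((L ^ k)⁻¹) ^ 2) := by ring
  rw [this]; linarith

/-- **THE SCALAR STEP OF THE LEVEL RECURSION** (k-uniformity): with `q_j := (Lʲ)⁴(Lᵏ)⁻⁴`, `r_j := 3T·q_j∕L²` and source `5c₁(L·δc·p_j)² = T·L²·q_j` (`T = 80c₁δc²ε₀²`,
`p_j = 4ε₀(Lʲ)²(Lᵏ)⁻²`), the window `33A ≤ 20L⁴` gives `(11∕10)·A·r_j + 5c₁(L·δc·p_j)² ≤ r_{j+1}` (`q_{j+1} = L⁴q_j`).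
[cite: Balaban1985Averaging, Prop. 4 (134)-(135) pp.38-39] (arithmetic) -/
theorem level_budget {L A c₁ δc ε₀ : ℝ} (hL : 1 ≤ L) (hA : 33 * A ≤ 20 * L ^ 4) (hc₁ : 0 ≤ c₁) (j k : ℕ) :
    (11 / 10) * A * (3 * (80 * c₁ * δc ^ 2 * ε₀ ^ 2) * ((L ^ j) ^ 4 * ((L ^ k)⁻¹) ^ 4) * (L ^ 2)⁻¹) +
        5 * c₁ * (L * (δc * (4 * ε₀ * (L ^ j) ^ 2 * ((L ^ k)⁻¹) ^ 2))) ^ 2 ≤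
      3 * (80 * c₁ * δc ^ 2 * ε₀ ^ 2) * ((L ^ (j + 1)) ^ 4 * ((L ^ k)⁻¹) ^ 4) * (L ^ 2)⁻¹ := by
  have hL0 : 0 < L := by linarith
  set T : ℝ := 80 * c₁ * δc ^ 2 * ε₀ ^ 2 with hT
  set q : ℝ := (L ^ j) ^ 4 * ((L ^ k)⁻¹) ^ 4 with hq
  have hT0 : 0 ≤ T := by positivity
  have hq0 : 0 ≤ q := by positivity
  have hsrc : 5 * c₁ * (L * (δc * (4 * ε₀ * (L ^ j) ^ 2 * ((L ^ k)⁻¹) ^ 2))) ^ 2 = T * L ^ 2 * q := by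
    rw [hT, hq]; ring
  have hpow : (L ^ (j + 1)) ^ 4 * ((L ^ k)⁻¹) ^ 4 = L ^ 4 * q := by rw [hq, pow_succ]; ring
  rw [hsrc, hpow]
  have hL2 : 0 < L ^ 2 := by positivity
  set u : ℝ := T * q with hu
  have hu0 : 0 ≤ u := mul_nonneg hT0 hq0
  have h1 : (11 / 10) * A * (3 * T * q * (L ^ 2)⁻¹) = ((33 / 10) * A * u) / L ^ 2 := by rw [hu]; ring
  have h2 : 3 * T * (L ^ 4 * q) * (L ^ 2)⁻¹ = 3 * L ^ 2 * u := by rw [hu]; field_simp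
  have h3 : T * L ^ 2 * q = L ^ 2 * u := by rw [hu]; ring
  have h4 : ((33 / 10) * A * u) / L ^ 2 ≤ 2 * L ^ 2 * u := by
    rw [div_le_iff₀ hL2]
    have : (33 / 10) * A ≤ 2 * L ^ 4 := by linarith
    nlinarith [mul_le_mul_of_nonneg_right this hu0]
  rw [h1, h2, h3]
  linarith

end Level

/-! ## §3 ★★★ The tower: B-al-2 modulo the step -/

section Tower

open scoped Matrix.Norms.L2Operator

/-- ★★★ **LEMMA B-al-2 MODULO THE STEP (B-iv) — THE COMB TOWER IS THE PULLED TORUS DOUBLE-BAR TOWER UP TO A k-UNIFORM SECOND-ORDER DEFECT, NO GAUGE FACTOR.**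
Member `(F, n, K)`, `k = K − n`, fine `SU(2)` field `U` and pre-gauge `gJ`, `X̂ := (U^{gJ})♭ = unitsField (toUField (gJ•U))`, `U′ := pull X̂ 0`.  HYPOTHESES: the STEP `hstep`
(w3 g10's (B-iv) CLAIM in GLOBAL form: for a `U1`-valued, everywhere block-axial `ℤ³` field `C` with plaquettes `≤ p` on every box and a torus field `D` with
`‖D(π_j b)⁻¹C(b) − 1‖ ≤ ρ` at every bond, under the two (B-iv) windows, `‖(U̿ D)(π_{j+1} c)⁻¹·(bavg L C)(Lz, κ) − 1‖ ≤ (11∕10)·A·ρ + 5·c₁·(L·δc·p)²`); the socket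
guards (a) `InAk` on `univ` and (b) block-axiality below the top; the scalar windows (Prop. 2: `C₀·2ε₀ ≤ 1∕3`, `4ε₀ ≤ c₂′`; (B-iv) at the top level; `33A ≤ 20L⁴`).
CONCLUSION (SIGNATURE v1 cea012fa VERBATIM, constant pinned): at EVERY top bond `(z, ν)` of `ℤ³`,
`‖(dbarIterU k X̂ ⟨π_k z, ν⟩)⁻¹ · avgIter L U′ k z ν − 1‖ ≤ 240·c₁·δc²·ε₀²`.
Proof: induction on the level with the invariant `ρ_j ≤ r_j = 3·80c₁δc²ε₀²·(Lʲ)⁴(Lᵏ)⁻⁴∕L²` (`level_budget`), base `base_level`, data `avgIter_mem_U1`∕`plaqSmall_avgIter_level`∕`hblk`.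
[cite: Balaban1985Averaging, (42)-(43) pp.23-24, Prop. 2 (54) p.26, (89) p.31, (127) p.36, Prop. 4 (134)-(135) pp.38-39; Balaban1987RG1, (0.4) p.253; Balaban1985RegularSpaces, (1.7) p.77, (1.15) p.78] -/
theorem comb_eq_dbar_mul_defect_of_step (hnK : n < K) {ε₀ : ℝ} (hε₀ : 0 < ε₀)
    {A c₁ δc : ℝ} (hc₁ : 0 ≤ c₁) (hδc : 0 ≤ δc)
    -- the STEP (B-iv), global form, at every level with two levels of room
    (hstep : ∀ (j : ℕ), j + 2 ≤ (F.P K).m + (F.P K).K →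
      ∀ (C : LSite (F.P K).d → Fin (F.P K).d → (Matrix (Fin 2) (Fin 2) ℂ)ˣ) (D : GaugeField (F.P K) j (Matrix (Fin 2) (Fin 2) ℂ)ˣ) (ρ p : ℝ),
      0 ≤ ρ → 0 ≤ p →
      (∀ x μ, C x μ ∈ U1 (Matrix (Fin 2) (Fin 2) ℂ)) →
      (∀ (z : LSite (F.P K).d) (r : Fin (F.P K).d → Fin (F.P K).L), axialFn C (((F.P K).L : ℤ) • z) (((F.P K).L : ℤ) • z + boxVec (F.P K).L r) = 1) →
      (∀ lo hi : LSite (F.P K).d, PlaqSmall C lo hi p) →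
      (∀ (x : LSite (F.P K).d) (μ : Fin (F.P K).d), ‖(((D ⟨coverAt (F.P K) j x, μ⟩)⁻¹ * C x μ : (Matrix (Fin 2) (Fin 2) ℂ)ˣ) : Matrix (Fin 2) (Fin 2) ℂ) - 1‖ ≤ ρ) →
      10 ^ 4 * ((((F.P K).d + 2) * (F.P K).L : ℕ) : ℝ) * (δc * p + 2 * ρ) ≤ 1 →
      ((F.P K).L : ℝ) * (2 * (δc * p)) ≤ c4 (F.P K).d →
      ∀ (z : LSite (F.P K).d) (κ : Fin (F.P K).d),
        ‖(((dbarAvgU D ⟨coverAt (F.P K) (j + 1) z, κ⟩)⁻¹ * bavg (F.P K).L C (((F.P K).L : ℤ) • z) κ : (Matrix (Fin 2) (Fin 2) ℂ)ˣ) :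
            Matrix (Fin 2) (Fin 2) ℂ) - 1‖ ≤ (11 / 10) * A * ρ + 5 * c₁ * (((F.P K).L : ℝ) * (δc * p)) ^ 2)
    -- the scalar windows (socket letters)
    (hα3 : C0 (F.P K).d * (2 * ε₀) ≤ 1 / 3) (hα2 : 2 * (2 * ε₀) ≤ c2' (F.P K).d (F.P K).L)
    (hw1 : 10 ^ 4 * ((((F.P K).d + 2) * (F.P K).L : ℕ) : ℝ) * (δc * (4 * ε₀) + 2 * (240 * c₁ * δc ^ 2 * ε₀ ^ 2)) ≤ 1)
    (hw2 : ((F.P K).L : ℝ) * (2 * (δc * (4 * ε₀))) ≤ c4 (F.P K).d)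
    (hA : 33 * A ≤ 20 * ((F.P K).L : ℝ) ^ 4)
    -- the member's field and pre-gauge; socket guards (a) and (b)
    (U : GaugeField (F.P K) 0 (Matrix.specialUnitaryGroup (Fin 2) ℂ)) (gJ : GaugeTransf (F.P K) 0 (Matrix.specialUnitaryGroup (Fin 2) ℂ))
    (hInAk : InAk (F.P K).L (K - n) (((F.L : ℝ)⁻¹) ^ (K - n)) ε₀ (fun _ => (Set.univ : Set (LSite (F.P K).d)))
      (pull (unitsField (toUField (GaugeField.gaugeAct gJ U))) 0))
    (hblk : ∀ m, m < K - n → ∀ (z : LSite (F.P K).d) (r : Fin (F.P K).d → Fin (F.P K).L),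
      axialFn (avgIter (F.P K).L (pull (unitsField (toUField (GaugeField.gaugeAct gJ U))) 0) (K - n - (m + 1))) (((F.P K).L : ℤ) • z)
        (((F.P K).L : ℤ) • z + boxVec (F.P K).L r) = 1)
    (z : LSite (F.P K).d) (ν : Fin (F.P K).d) :
    ‖(((dbarIterU (K - n) (unitsField (toUField (GaugeField.gaugeAct gJ U))) ⟨coverAt (F.P K) (K - n) z, ν⟩)⁻¹ *
          avgIter (F.P K).L (pull (unitsField (toUField (GaugeField.gaugeAct gJ U))) 0) (K - n) z ν : (Matrix (Fin 2) (Fin 2) ℂ)ˣ) :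
        Matrix (Fin 2) (Fin 2) ℂ) - 1‖ ≤ 240 * c₁ * δc ^ 2 * ε₀ ^ 2 := by
  -- letters
  set X : GaugeField (F.P K) 0 (Matrix (Fin 2) (Fin 2) ℂ)ˣ := unitsField (toUField (GaugeField.gaugeAct gJ U)) with hX
  set U' : LSite (F.P K).d → Fin (F.P K).d → (Matrix (Fin 2) (Fin 2) ℂ)ˣ := pull X 0 with hU'
  set k : ℕ := K - n with hk
  set Lr : ℝ := ((F.P K).L : ℝ) with hLr
  have hL2 : 2 ≤ (F.P K).L := (F.P K).hL.2
  have hL1 : (1 : ℝ) ≤ Lr := by rw [hLr]; exact_mod_cast (le_trans (by norm_num) hL2)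
  have hL0 : (0 : ℝ) < Lr := by linarith
  have hkm : K - n ≤ (F.P K).m + (F.P K).K := by show K - n ≤ F.m + K; omega
  have hroom : ∀ j, j + 1 ≤ k → j + 2 ≤ (F.P K).m + (F.P K).K := by
    intro j hj; show j + 2 ≤ F.m + K; have := F.hm; omega
  -- the fine data: `U′` is `SU(2)`-valued with (52) at threshold `2ε₀L^{−2k}`
  have hU'G : ∀ w κ, U' w κ ∈ specialUnitaryUnits (Fin 2) := pull_toUField_mem (GaugeField.gaugeAct gJ U) 0
  have hFL : (F.L : ℝ) = Lr := by rw [hLr]; rfl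
  have h52 : pdev U' < 2 * ε₀ * ((Lr ^ k)⁻¹) ^ 2 := by
    have h := pdev_pull_lt hε₀ hInAk 0
    rw [hLr]; exact h
  -- the invariant bound
  set T : ℝ := 80 * c₁ * δc ^ 2 * ε₀ ^ 2 with hT
  have hT0 : 0 ≤ T := by positivity
  set r : ℕ → ℝ := fun j => 3 * T * ((Lr ^ j) ^ 4 * ((Lr ^ k)⁻¹) ^ 4) * (Lr ^ 2)⁻¹ with hr
  have hr0 : ∀ j, 0 ≤ r j := fun j => by positivity
  have hr_le : ∀ j, j ≤ k → r j ≤ 240 * c₁ * δc ^ 2 * ε₀ ^ 2 := by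
    intro j hj
    have hq : (Lr ^ j) ^ 4 * ((Lr ^ k)⁻¹) ^ 4 ≤ 1 := by
      rw [← mul_pow, ← div_eq_mul_inv]
      have h1 : Lr ^ j / Lr ^ k ≤ 1 := (div_le_one (pow_pos hL0 k)).mpr (pow_le_pow_right₀ hL1 hj)
      have h0 : 0 ≤ Lr ^ j / Lr ^ k := by positivity
      exact pow_le_one₀ h0 h1
    have hL2inv : (Lr ^ 2)⁻¹ ≤ 1 := inv_le_one_of_one_le₀ (one_le_pow₀ hL1)
    have h3T : 3 * T = 240 * c₁ * δc ^ 2 * ε₀ ^ 2 := by rw [hT]; ring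
    calc r j = 3 * T * (((Lr ^ j) ^ 4 * ((Lr ^ k)⁻¹) ^ 4) * (Lr ^ 2)⁻¹) := by rw [hr]; ring
      _ ≤ 3 * T * (1 * 1) := mul_le_mul_of_nonneg_left (mul_le_mul hq hL2inv (by positivity) zero_le_one) (by positivity)
      _ = 240 * c₁ * δc ^ 2 * ε₀ ^ 2 := by rw [mul_one, mul_one, h3T]
  -- THE INDUCTION: `H_j` with bound `r j` for every `j ≤ k`
  have main : ∀ j, j ≤ k → ∀ (x : LSite (F.P K).d) (μ : Fin (F.P K).d),
      ‖((((dbarIterU j X) ⟨coverAt (F.P K) j x, μ⟩)⁻¹ * avgIter (F.P K).L U' j x μ : (Matrix (Fin 2) (Fin 2) ℂ)ˣ) : Matrix (Fin 2) (Fin 2) ℂ) - 1‖ ≤ r j := by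
    intro j
    induction j with
    | zero =>
      intro _ x μ
      rw [base_level]
      exact hr0 0
    | succ j ih =>
      intro hj1 w κ
      have hjk : j ≤ k := Nat.le_of_succ_le hj1
      have hH := ih hjk
      -- per-level data
      set p : ℝ := 4 * ε₀ * (Lr ^ j) ^ 2 * ((Lr ^ k)⁻¹) ^ 2 with hp
      have hp0 : 0 ≤ p := by positivity
      have hp4 : p ≤ 4 * ε₀ := p_level_le hL1 hε₀.le hjk
      have hCU : ∀ x μ, avgIter (F.P K).L U' j x μ ∈ U1 (Matrix (Fin 2) (Fin 2) ℂ) :=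
        fun x μ => avgIter_mem_U1 U' hU'G hε₀ hα3 hα2 (by rw [← hLr]; exact h52) hjk x μ
      have hCP : ∀ lo hi, PlaqSmall (avgIter (F.P K).L U' j) lo hi p := fun lo hi => by
        have h := plaqSmall_avgIter_level U' hU'G hε₀ hα3 hα2 (k := k) (by rw [← hLr]; exact h52) hjk lo hi
        rw [hp, hLr]; exact h
      have hCax : ∀ (zz : LSite (F.P K).d) (rr : Fin (F.P K).d → Fin (F.P K).L),
          axialFn (avgIter (F.P K).L U' j) (((F.P K).L : ℤ) • zz) (((F.P K).L : ℤ) • zz + boxVec (F.P K).L rr) = 1 := by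
        intro zz rr
        have hm : k - 1 - j < K - n := by omega
        have h := hblk (k - 1 - j) hm zz rr
        have hidx : K - n - (k - 1 - j + 1) = j := by omega
        rw [hidx] at h
        exact h
      -- windows at level `j`
      have hrj := hr_le j hjk
      have hwin1 : 10 ^ 4 * ((((F.P K).d + 2) * (F.P K).L : ℕ) : ℝ) * (δc * p + 2 * r j) ≤ 1 := by
        have hℓ0 : (0 : ℝ) ≤ 10 ^ 4 * ((((F.P K).d + 2) * (F.P K).L : ℕ) : ℝ) := by positivity
        have hmono : δc * p + 2 * r j ≤ δc * (4 * ε₀) + 2 * (240 * c₁ * δc ^ 2 * ε₀ ^ 2) :=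
          add_le_add (mul_le_mul_of_nonneg_left hp4 hδc) (by linarith)
        exact (mul_le_mul_of_nonneg_left hmono hℓ0).trans hw1
      have hwin2 : ((F.P K).L : ℝ) * (2 * (δc * p)) ≤ c4 (F.P K).d := by
        have hL0' : (0 : ℝ) ≤ ((F.P K).L : ℝ) := Nat.cast_nonneg _
        have hmono : 2 * (δc * p) ≤ 2 * (δc * (4 * ε₀)) := by nlinarith [mul_le_mul_of_nonneg_left hp4 hδc]
        exact (mul_le_mul_of_nonneg_left hmono hL0').trans hw2
      -- THE STEP
      have hS := hstep j (hroom j hj1) (avgIter (F.P K).L U' j) (dbarIterU j X) (r j) p (hr0 j) hp0 hCU hCax hCP hH hwin1 hwin2 w κ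
      -- read the two towers at level `j+1`
      rw [dbarIterU_succ, avgIter_succ, rescale_apply]
      refine hS.trans ?_
      -- the scalar budget
      have hb := level_budget (δc := δc) (ε₀ := ε₀) hL1 (by rw [hLr] at hA ⊢; exact hA) hc₁ j k
      rw [hr]
      simpa only [hLr] using hb
  have h := main k le_rfl z ν
  exact h.trans (hr_le k le_rfl)

/-- **BLOCK-AXIALITY BELOW THE TOP FROM THE SOCKET's `InAx` GUARD**: `U′ ∈ Ax_{k}(ℭ, 1)` for EVERY family `ℭ` (in particular `Λ_j = ℤ³`) says, by (1.19) ⟺ (1.15)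
(lit ✓`inAx_iff`, `1̄ⁿ = 1`), that the comb tower `avgIter L U′ (k − (m+1))` is block-axial on every block, `m < k` — SIGNATURE v1's `hblk` in the door's guard letters.
[cite: Balaban1985RegularSpaces, (1.15) p.78, (1.19)-(1.20) p.79, (1.34) p.82] -/
theorem hblk_of_inAx {P : Params} {𝔸 : Type*} [NormedRing 𝔸] [NormedAlgebra ℂ 𝔸] [CompleteSpace 𝔸] (U' : LSite P.d → Fin P.d → 𝔸ˣ) {k : ℕ}
    (hInAx : ∀ m, m ≤ k → ∀ Λ : ℕ → Set (LSite P.d), InAx P.L m Λ (1 : LSite P.d → Fin P.d → 𝔸ˣ) U') :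
    ∀ m, m < k → ∀ (z : LSite P.d) (r : Fin P.d → Fin P.L),
      axialFn (avgIter P.L U' (k - (m + 1))) ((P.L : ℤ) • z) ((P.L : ℤ) • z + boxVec P.L r) = 1 := by
  intro m hm z r
  have h := (inAx_iff P.L k (fun _ => (Set.univ : Set (LSite P.d))) 1 U').1 (hInAx k le_rfl _) (k - m) (by omega) (by omega) z (Set.mem_univ _)
    (k - (m + 1)) (by omega) z ?_ r
  · rw [h, B8Ineq132.avgIter_one, B8Ineq130.axialFn_one]
  · intro i
    have : k - m - (k - (m + 1) + 1) = 0 := by omega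
    rw [this, pow_zero, one_mul, one_mul]
    exact ⟨le_rfl, le_rfl⟩

/-- ★★★ **THE SAME, IN THE B-al-3 DOOR's TWO GUARD LETTERS** (w3-20520 g9's `…HStokesRowOfCombDefect` v2 closes (R-cmp) under exactly `InAk … univ U′` and
`∀ m′ ≤ K−n, ∀ Λ, InAx … m′ Λ 1 U′`): block-axiality `hblk` is DERIVED from the `InAx` guard (`hblk_of_inAx`); the scalar windows stay displayed for the v10 pack.
[cite: Balaban1985Averaging, Prop. 4 (134)-(135) pp.38-39; Balaban1985RegularSpaces, (1.19) p.79, (1.34) p.82] -/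
theorem comb_eq_dbar_mul_defect_of_step_inAx (hnK : n < K) {ε₀ : ℝ} (hε₀ : 0 < ε₀)
    {A c₁ δc : ℝ} (hc₁ : 0 ≤ c₁) (hδc : 0 ≤ δc)
    (hstep : ∀ (j : ℕ), j + 2 ≤ (F.P K).m + (F.P K).K →
      ∀ (C : LSite (F.P K).d → Fin (F.P K).d → (Matrix (Fin 2) (Fin 2) ℂ)ˣ) (D : GaugeField (F.P K) j (Matrix (Fin 2) (Fin 2) ℂ)ˣ) (ρ p : ℝ),
      0 ≤ ρ → 0 ≤ p →
      (∀ x μ, C x μ ∈ U1 (Matrix (Fin 2) (Fin 2) ℂ)) →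
      (∀ (z : LSite (F.P K).d) (r : Fin (F.P K).d → Fin (F.P K).L), axialFn C (((F.P K).L : ℤ) • z) (((F.P K).L : ℤ) • z + boxVec (F.P K).L r) = 1) →
      (∀ lo hi : LSite (F.P K).d, PlaqSmall C lo hi p) →
      (∀ (x : LSite (F.P K).d) (μ : Fin (F.P K).d), ‖(((D ⟨coverAt (F.P K) j x, μ⟩)⁻¹ * C x μ : (Matrix (Fin 2) (Fin 2) ℂ)ˣ) : Matrix (Fin 2) (Fin 2) ℂ) - 1‖ ≤ ρ) →
      10 ^ 4 * ((((F.P K).d + 2) * (F.P K).L : ℕ) : ℝ) * (δc * p + 2 * ρ) ≤ 1 →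
      ((F.P K).L : ℝ) * (2 * (δc * p)) ≤ c4 (F.P K).d →
      ∀ (z : LSite (F.P K).d) (κ : Fin (F.P K).d),
        ‖(((dbarAvgU D ⟨coverAt (F.P K) (j + 1) z, κ⟩)⁻¹ * bavg (F.P K).L C (((F.P K).L : ℤ) • z) κ : (Matrix (Fin 2) (Fin 2) ℂ)ˣ) :
            Matrix (Fin 2) (Fin 2) ℂ) - 1‖ ≤ (11 / 10) * A * ρ + 5 * c₁ * (((F.P K).L : ℝ) * (δc * p)) ^ 2)
    (hα3 : C0 (F.P K).d * (2 * ε₀) ≤ 1 / 3) (hα2 : 2 * (2 * ε₀) ≤ c2' (F.P K).d (F.P K).L)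
    (hw1 : 10 ^ 4 * ((((F.P K).d + 2) * (F.P K).L : ℕ) : ℝ) * (δc * (4 * ε₀) + 2 * (240 * c₁ * δc ^ 2 * ε₀ ^ 2)) ≤ 1)
    (hw2 : ((F.P K).L : ℝ) * (2 * (δc * (4 * ε₀))) ≤ c4 (F.P K).d)
    (hA : 33 * A ≤ 20 * ((F.P K).L : ℝ) ^ 4)
    (U : GaugeField (F.P K) 0 (Matrix.specialUnitaryGroup (Fin 2) ℂ)) (gJ : GaugeTransf (F.P K) 0 (Matrix.specialUnitaryGroup (Fin 2) ℂ))
    (hInAk : InAk (F.P K).L (K - n) (((F.L : ℝ)⁻¹) ^ (K - n)) ε₀ (fun _ => (Set.univ : Set (LSite (F.P K).d)))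
      (pull (unitsField (toUField (GaugeField.gaugeAct gJ U))) 0))
    (hInAx : ∀ m, m ≤ K - n → ∀ Λ : ℕ → Set (LSite (F.P K).d),
      InAx (F.P K).L m Λ (1 : LSite (F.P K).d → Fin (F.P K).d → (Matrix (Fin 2) (Fin 2) ℂ)ˣ) (pull (unitsField (toUField (GaugeField.gaugeAct gJ U))) 0))
    (z : LSite (F.P K).d) (ν : Fin (F.P K).d) :
    ‖(((dbarIterU (K - n) (unitsField (toUField (GaugeField.gaugeAct gJ U))) ⟨coverAt (F.P K) (K - n) z, ν⟩)⁻¹ *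
          avgIter (F.P K).L (pull (unitsField (toUField (GaugeField.gaugeAct gJ U))) 0) (K - n) z ν : (Matrix (Fin 2) (Fin 2) ℂ)ˣ) :
        Matrix (Fin 2) (Fin 2) ℂ) - 1‖ ≤ 240 * c₁ * δc ^ 2 * ε₀ ^ 2 :=
  comb_eq_dbar_mul_defect_of_step F hnK hε₀ hc₁ hδc hstep hα3 hα2 hw1 hw2 hA U gJ hInAk (hblk_of_inAx _ hInAx) z ν

end Tower

end Summit.QuantumFields.YangMills.Theorems.HalvingCombTorusTower

end
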